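import Mathlib.Algebra.Order.Floor.Defs
import Mathlib.Algebra.Order.Floor.Ring
import Mathlib.Algebra.Order.Field.Basic
import Mathlib.Algebra.BigOperators.Group.Finset.Basic
import Mathlib.Algebra.Ring.Parity
import Mathlib.Data.Rat.Floor
import Mathlib.MeasureTheory.Integral.IntervalIntegral.Basic
import Mathlib.Tactic.Linarith
import Mathlib.Tactic.Positivity
import Mathlib.Tactic.Ring
import Mathlib.Tactic.FieldSimp
import Literature.ComputerArithmetic.P3109.StochasticModes
import HarnessLib

/-!
# Fitzgibbon–Felix 2025: stochastic rounding with few random bits — the modes SRFF / SRF / SRC and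
# their input-averaged bias

HONEST FRAMING: certified error envelopes and provably optimal rounding/accumulation schemes for
low-precision formats under stated cost models; every table by two implementations; no hardware
or vendor claims.

Source. A. Fitzgibbon, S. Felix, *On Stochastic Rounding with Few Random Bits*, 32nd IEEE
Symposium on Computer Arithmetic (ARITH 2025), 133–140, doi:10.1109/arith64983.2025.00029 =
arXiv:2504.20634 [cite: FitzgibbonFelix2025]. Section / equation pointers are to the arXiv version.

What is typed here (verbatim; `δ̃ ∈ [0,1)` is the residual of the value to be rounded on the gap of
the target format, "round away iff `R(δ̃, noise)`", `N` = number of random bits, `0 ≤ n < 2^N`):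
* §II-B: `R_SR(δ̃) = [δ̃ + ñ ≥ 1]` (`ñ` uniform on `[0,1)`), `R_SRFF(δ̃, n) = [δ̃ + n × 2^{-N} ≥ 1]`
  ("faster"), `R_SRF(δ̃, n) = [δ̃ + (n + ½) × 2^{-N} ≥ 1]` ("fast") — `RSR`, `RSRFF`, `RSRF`;
* §III-F eq. (8): `R_SRC(δ̃, n) = R_SRFF(Round(δ̃ × 2^N) × 2^{-N}, n)`, "where Round is any unbiased
  rounding scheme, e.g. round to nearest, with ties to even or odd" ("corrected") — `RSRC Round`;
* §III-B: the bias functionals — continuous residuals ("values between each pair of floats are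
  unbiased on average", eq. (6)): `2^{-N} Σ_{n<2^N} ∫₀¹ 1[R(x,n)] dx − ½` (`contBias`); finite-precision
  inputs with `D` excess bits (§III-E, eq. (7), App. A-C/A-D): the pointwise bias
  `2^{-N} Σ_{n<2^N} 1[R(x,n)] − x` averaged over the `2^D` residuals `x = 2^{-D} i` (`pointBias`,
  `gridBias`);
* the paper's RESULTS as named facts: §III-C/App. A-A `bias_SRFF = −2^{-(N+1)} ≠ 0`
  (`SRFFContBias`); §III-D/A-B `bias_SRF = 0` (`SRFContBias`); §III-E/A-C
  `bias_{SRFF,D} ≤ (2^{-D} − 2^{-N})/2`, "tight for `N ≤ D`", "zero for `N = D`" (`SRFFGridBiasLe`,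
  `SRFFGridBias`); §III-E/A-D `bias_{SRF,D} ≤ 2^{-(D+1)}`, exact for `N < D` ("the bias depends on
  `D` but is independent of `N`") (`SRFGridBiasLe`, `SRFGridBias`); §III-F "This reduces the problem
  to the `N = D′` case, which is unbiased for SRFF" (`SRCGridBias`, typed with an explicit `Round`
  and the hypothesis `1 ≤ N ≤ D` under which the reduction is stated).  The facts are stated over
  `ℝ` (the definitions over any linear ordered field `K`).
Nothing is proved here.  The identification of SRFF / SRF / SRC (with round-to-nearest-even) with
the IEEE P3109 modes StochasticA / B / C (`Literature.ComputerArithmetic.P3109`), the exact values of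
all these averages for every `(N, D)` (including the regime `N ≥ D`, the `N = 0` and the ties-away
caveats of SRC) and hence proofs / corrections of the facts below are venture work
(`Summits/Ventures/CertifiedArithmetic/LowPrec/SRFewBitsAverageBias.lean`).  The empirical §IV
(language-model training) is out of scope.  No claim about any implementation.
-/

namespace Literature.ComputerArithmetic.FitzgibbonFelix2025

open Finset

section Modes

variable {K : Type*} [Field K] [LinearOrder K] [IsStrictOrderedRing K]

/-- [cite: FitzgibbonFelix2025, §II-B] Infinite-randomness stochastic rounding: with residual `δ̃`
and noise `ñ` (uniform on `[0,1)`), round away iff `δ̃ + ñ ≥ 1`. -/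
def RSR (δ noise : K) : Prop := 1 ≤ δ + noise

/-- [cite: FitzgibbonFelix2025, §II-B] `R_SRFF(δ̃, n) = [δ̃ + n × 2^{-N} ≥ 1]` for random bits
`0 ≤ n < 2^N` ("SR faster"). -/
def RSRFF (N : ℕ) (δ : K) (n : ℕ) : Prop := 1 ≤ δ + (n : K) / 2 ^ N

/-- [cite: FitzgibbonFelix2025, §II-B] `R_SRF(δ̃, n) = [δ̃ + (n + ½) × 2^{-N} ≥ 1]` ("SR fast"). -/
def RSRF (N : ℕ) (δ : K) (n : ℕ) : Prop := 1 ≤ δ + ((n : K) + 1 / 2) / 2 ^ N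

/-- [cite: FitzgibbonFelix2025, §III-F eq. (8)] `R_SRC(δ̃, n) = R_SRFF(Round(δ̃ × 2^N) × 2^{-N}, n)`:
first round the residual deterministically to `N` bits with the integer rounding `Round`
("any unbiased rounding scheme, e.g. round to nearest, with ties to even or odd"), then SRFF
("SR corrected"). -/
def RSRC (Round : K → ℤ) (N : ℕ) (δ : K) (n : ℕ) : Prop :=
  RSRFF N ((Round (δ * 2 ^ N) : K) / 2 ^ N) n

/-- [folklore] `R_SRFF` is decidable (an order comparison; instance plumbing). -/
instance instDecidableRSRFF (N : ℕ) (δ : K) (n : ℕ) : Decidable (RSRFF N δ n) := by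
  unfold RSRFF; infer_instance

/-- [folklore] `R_SRF` is decidable (an order comparison; instance plumbing). -/
instance instDecidableRSRF (N : ℕ) (δ : K) (n : ℕ) : Decidable (RSRF N δ n) := by
  unfold RSRF; infer_instance

/-- [folklore] `R_SRC` is decidable (an order comparison; instance plumbing). -/
instance instDecidableRSRC (Round : K → ℤ) (N : ℕ) (δ : K) (n : ℕ) :
    Decidable (RSRC Round N δ n) := by
  unfold RSRC; infer_instance

/-! ### Bias functionals for finite-precision inputs (§III-E, App. A-C/A-D) -/

/-- [cite: FitzgibbonFelix2025, App. A-C] Pointwise few-bit bias of the rounding predicate `R` with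
`N` random bits at residual `x`: `bias(x) = 2^{-N} Σ_{n<2^N} 1[R(x, n)] − x`
(probability of rounding away minus the exact-SR probability `x`). -/
def pointBias (R : K → ℕ → Prop) [∀ x n, Decidable (R x n)] (N : ℕ) (x : K) : K :=
  (∑ n ∈ range (2 ^ N), if R x n then (1 : K) else 0) / 2 ^ N - x

/-- [cite: FitzgibbonFelix2025, §III-E eq. (7), App. A-C/A-D] Average bias over the `2^D` equally
likely residuals `x = 2^{-D} i`, `0 ≤ i < 2^D`, of inputs with `D` excess bits:
`bias_{R,D} = 2^{-D} Σ_{i<2^D} bias(2^{-D} i)`. -/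
def gridBias (R : K → ℕ → Prop) [∀ x n, Decidable (R x n)] (N D : ℕ) : K :=
  (∑ i ∈ range (2 ^ D), pointBias R N ((i : K) / 2 ^ D)) / 2 ^ D

end Modes

/-! ### Bias functional for infinite-precision inputs (§III-B, App. A-A/A-B) -/

/-- [cite: FitzgibbonFelix2025, §III-B] With residuals uniform on `[0,1)` (test family (6): uniform
between consecutive floats) and `N` uniformly random bits, the bias of the predicate `R` is
`2^{-N} Σ_{n<2^N} ∫₀¹ 1[R(x, n)] dx − ½`. -/
noncomputable def contBias (R : ℝ → ℕ → Prop) [∀ x n, Decidable (R x n)] (N : ℕ) : ℝ :=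
  (∑ n ∈ range (2 ^ N), ∫ x in (0 : ℝ)..1, (if R x n then (1 : ℝ) else 0)) / 2 ^ N - 1 / 2

/-! ### The paper's results, as named facts (nothing proved here) -/

/-- [cite: FitzgibbonFelix2025, §III-C, App. A-A] "Hence SRFF is biased": for infinite-precision
inputs `bias_SRFF = −2^{-(N+1)} ≠ 0`. -/
def SRFFContBias : Prop := ∀ N : ℕ, contBias (RSRFF (K := ℝ) N) N = -(1 / 2 ^ (N + 1))

/-- [cite: FitzgibbonFelix2025, §III-D, App. A-B] "SRF is unbiased, in that the expectation
computed over all real values between two floats is zero": `bias_SRF = 0`. -/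
def SRFContBias : Prop := ∀ N : ℕ, contBias (RSRF (K := ℝ) N) N = 0

/-- [cite: FitzgibbonFelix2025, §III-E, App. A-C] Finite-precision inputs, `D` excess bits (real
residuals on the grid `2^{-D} i`): `bias_{SRFF,D} ≤ (2^{-D} − 2^{-N})/2` (obtained with `⌊x⌋ ≤ x`). -/
def SRFFGridBiasLe : Prop :=
  ∀ N D : ℕ, gridBias (RSRFF (K := ℝ) N) N D ≤ (1 / 2 ^ D - 1 / 2 ^ N) / 2

/-- [cite: FitzgibbonFelix2025, §III-E, App. A-C] … "tight for `N ≤ D`": then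
`bias_{SRFF,D} = (2^{-D} − 2^{-N})/2`, "from which it is clear that the bias is zero for `N = D`". -/
def SRFFGridBias : Prop :=
  ∀ N D : ℕ, N ≤ D → gridBias (RSRFF (K := ℝ) N) N D = (1 / 2 ^ D - 1 / 2 ^ N) / 2

/-- [cite: FitzgibbonFelix2025, §III-E, App. A-D] "It is not sufficient to use SRF, which also has
a bias … bounded by `bias_{SRF,D} ≤ 2^{-(D+1)}`". -/
def SRFGridBiasLe : Prop := ∀ N D : ℕ, gridBias (RSRF (K := ℝ) N) N D ≤ 1 / 2 ^ (D + 1)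

/-- [cite: FitzgibbonFelix2025, App. A-D] … with equality for `N < D` ("the bias depends on `D`
but is independent of `N`"). -/
def SRFGridBias : Prop := ∀ N D : ℕ, N < D → gridBias (RSRF (K := ℝ) N) N D = 1 / 2 ^ (D + 1)

/-- [cite: FitzgibbonFelix2025, §III-F] SRC "reduces the problem to the `N = D′` case, which is
unbiased for SRFF": with the pre-rounding `Round` of (8) taken to be round-to-nearest-ties-to-even
(the paper's first example; = `RNITE` of the P3109 interim report it cites as [14],
`Literature.ComputerArithmetic.P3109.rnite`) and `1 ≤ N ≤ D` random bits, the finite-precision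
average bias vanishes.  (The venture file proves it, and shows it FAILS for ties-away pre-rounding
and for `N = 0`; the ties-to-odd variant is not typed here.) -/
def SRCGridBias : Prop :=
  ∀ N D : ℕ, 1 ≤ N → N ≤ D →
    gridBias (RSRC (K := ℝ) (fun y => Literature.ComputerArithmetic.P3109.rnite y) N) N D = 0

end Literature.ComputerArithmetic.FitzgibbonFelix2025
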